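import Literature.NumberTheory.LFunctions.Zhang2022.RepairWindowFormDesign

/-!
# Zhang (2022), repair rung F-S1R, K-S2 (window part, restriction step): the one-window form `Xw`
# as five integrals of explicit smooth integrands over the window `[1−ν_b, ν_a]`

Y. Zhang, *Discrete mean estimates and the Landau–Siegel zero*, arXiv:2211.02515v1 (2022)
[Zhang2022LandauSiegel] — an unrefereed manuscript under adjudication; nothing here is a claim about
its Theorems 1–2. Follow-on of `RepairWindowFormDesign` (`WT = ῑ₄·Xw(ν₁,k₁;ν₂,k₂) + ῑ₃·Xw(ν₁,k₁;ν₃,k₃)`):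
the one-window form `Xw ν_a k_a ν_b k_b = W(ϰ_a, R̃ϰ_b)` is an integral over `[0,1]` of products carrying
indicators, a reflection and an inner primitive; here it is rewritten as a combination of FIVE integrals
over the window `[1−ν_b, ν_a]` (length `L = ν_a + ν_b − 1 ≥ 0`) of the explicit smooth formulas
(`kapSm`, `kapSm'` = the branches of `kappaP`, `kappaP'`; the inner primitive `∫_{1−x}^1 ϰ_b` =
`kappaTail ν_b k_b (1−x)` in closed form, `RepairKappaProfile`):

`Xw = −(8/π)·J₁ + 88π·J₂ − 24i(J₃ + J₄) − 48π²i·J₅`,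
`J₁ = ∫ ϰ_a′(y)ϰ_b′(1−y)`, `J₂ = ∫ ϰ_a(y)ϰ_b(1−y)`, `J₃ = ∫ ϰ_a′(y)ϰ_b(1−y)`, `J₄ = ∫ ϰ_a(y)ϰ_b′(1−y)`,
`J₅ = ∫ ϰ_a(x)·kappaTail ν_b k_b (1−x)`, all over `[1−ν_b, ν_a]` (`Xw_eq_window_integrals`).

The signs: `conj (R̃ϰ_b)′(y) = −ϰ_b′(1−y)` (`reflDeriv`), so `⟨u′,v′⟩ = −J₁` and
`⟨u′,v⟩ − ⟨u,v′⟩ = J₃ + J₄`. Outside the window every integrand vanishes (including at the window's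
endpoints, where `ϰ_a(ν_a) = ϰ_a′(ν_a) = 0` and `ϰ_b(ν_b) = ϰ_b′(ν_b) = ∫_{ν_b}^1ϰ_b = 0`), and inside the
OPEN window the indicator branches are the smooth formulas (`intervalIntegral.integral_congr_uIoo`).
Each `J` is an integral of (polynomial of degree ≤ 2) × `e^{iπ((k_b−k_a)y + const)}` (plus, in `J₅`, a
term × `e^{−iπk_a y}`), i.e. an `expQuadInt`/`polyInt` closed form after the substitution
`r = y − (1−ν_b)` — the evaluation step (`repair/p1/KS2-WINDOW.md` §2). Calculus bookkeeping; no `Prop` facts.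
-/

noncomputable section

open Complex Real ComplexConjugate Set MeasureTheory intervalIntegral

namespace Literature.NumberTheory.LFunctions.Zhang2022

namespace Repair

/-! ### The smooth branches of `ϰ`, `ϰ′` -/

/-- The smooth branch of `ϰ(ν,k)`: `(1 − y/ν)e^{iπk(ν−y)}` (= `kappaP ν k y` for `y ≤ ν`).
[cite: Zhang2022LandauSiegel, (2.23)–(2.25)] -/
def kapSm (ν k : ℝ) (y : ℝ) : ℂ := (((1 - y / ν : ℝ)) : ℂ) * cexp ((k : ℂ) * π * I * ((ν - y : ℝ) : ℂ))

/-- The smooth branch of `ϰ′(ν,k)`: `−(1/ν)(1 + iπk(ν−y))e^{iπk(ν−y)}` (= `kappaP' ν k y` for `y < ν`).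
[cite: Zhang2022LandauSiegel, (2.23)–(2.25)] -/
def kapSm' (ν k : ℝ) (y : ℝ) : ℂ :=
  -(((1 / ν : ℝ)) : ℂ) * ((1 + (k : ℂ) * π * I * ((ν - y : ℝ) : ℂ)) * cexp ((k : ℂ) * π * I * ((ν - y : ℝ) : ℂ)))

/-- [cite: Zhang2022LandauSiegel, (2.23)–(2.25)] -/
theorem kappaP_eq_kapSm {ν k y : ℝ} (hy : y ≤ ν) : kappaP ν k y = kapSm ν k y := kappaP_of_le hy
/-- [cite: Zhang2022LandauSiegel, (2.23)–(2.25)] -/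
theorem kappaP'_eq_kapSm' {ν k y : ℝ} (hy : y < ν) : kappaP' ν k y = kapSm' ν k y := kappaP'_of_lt hy

/-- `kapSm` is continuous. [cite: Zhang2022LandauSiegel, (2.23)–(2.25)] -/
theorem continuous_kapSm (ν k : ℝ) : Continuous (kapSm ν k) := by unfold kapSm; fun_prop
/-- `kapSm'` is continuous. [cite: Zhang2022LandauSiegel, (2.23)–(2.25)] -/
theorem continuous_kapSm' (ν k : ℝ) : Continuous (kapSm' ν k) := by unfold kapSm'; fun_prop

/-! ### The window integrals -/

/-- `J₁ = ∫_{1−ν_b}^{ν_a} ϰ_a′(y)ϰ_b′(1−y) dy`. [cite: Zhang2022LandauSiegel, §12 (12.12)–(12.14)] -/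
def J1w (νa ka νb kb : ℝ) : ℂ := ∫ y in (1 - νb)..νa, kapSm' νa ka y * kapSm' νb kb (1 - y)
/-- `J₂ = ∫_{1−ν_b}^{ν_a} ϰ_a(y)ϰ_b(1−y) dy`. [cite: Zhang2022LandauSiegel, §12 (12.12)–(12.14)] -/
def J2w (νa ka νb kb : ℝ) : ℂ := ∫ y in (1 - νb)..νa, kapSm νa ka y * kapSm νb kb (1 - y)
/-- `J₃ = ∫_{1−ν_b}^{ν_a} ϰ_a′(y)ϰ_b(1−y) dy`. [cite: Zhang2022LandauSiegel, §12 (12.12)–(12.14)] -/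
def J3w (νa ka νb kb : ℝ) : ℂ := ∫ y in (1 - νb)..νa, kapSm' νa ka y * kapSm νb kb (1 - y)
/-- `J₄ = ∫_{1−ν_b}^{ν_a} ϰ_a(y)ϰ_b′(1−y) dy`. [cite: Zhang2022LandauSiegel, §12 (12.12)–(12.14)] -/
def J4w (νa ka νb kb : ℝ) : ℂ := ∫ y in (1 - νb)..νa, kapSm νa ka y * kapSm' νb kb (1 - y)
/-- `J₅ = ∫_{1−ν_b}^{ν_a} ϰ_a(x)·(∫_{1−x}^{1} ϰ_b) dx` with the inner tail in closed form `kappaTail ν_b k_b (1−x)`.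
[cite: Zhang2022LandauSiegel, §12 (12.12)–(12.14)] -/
def J5w (νa ka νb kb : ℝ) : ℂ := ∫ x in (1 - νb)..νa, kapSm νa ka x * kappaTail νb kb (1 - x)

/-! ### A generic restriction lemma -/

/-- If an integrable `f` on `[0,1]` vanishes on `[0,c]` and on `[d,1]` (`0 ≤ c ≤ d ≤ 1`) and agrees with `g`
on the open window `(c,d)`, then `∫₀¹ f = ∫_c^d g`. [cite: Zhang2022LandauSiegel, §12 (12.12)–(12.14)] -/
theorem integral_unit_eq_window {f g : ℝ → ℂ} {c d : ℝ} (hf : IntervalIntegrable f volume 0 1)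
    (h0 : 0 ≤ c) (hcd : c ≤ d) (hd : d ≤ 1) (hzl : ∀ y ∈ Icc 0 c, f y = 0) (hzr : ∀ y ∈ Icc d 1, f y = 0)
    (hg : EqOn f g (Ioo c d)) : ∫ y in (0:ℝ)..1, f y = ∫ y in c..d, g y := by
  have h01 : uIcc (0:ℝ) 1 = Icc 0 1 := uIcc_of_le zero_le_one
  have hic : IntervalIntegrable f volume 0 c :=
    hf.mono_set (by rw [h01, uIcc_of_le h0]; exact Icc_subset_Icc_right (hcd.trans hd))
  have hcd' : IntervalIntegrable f volume c d :=
    hf.mono_set (by rw [h01, uIcc_of_le hcd]; exact Icc_subset_Icc h0 hd)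
  have hd1 : IntervalIntegrable f volume d 1 :=
    hf.mono_set (by rw [h01, uIcc_of_le hd]; exact Icc_subset_Icc_left (h0.trans hcd))
  have z1 : ∫ y in (0:ℝ)..c, f y = 0 := by
    have e : ∫ y in (0:ℝ)..c, f y = ∫ _ in (0:ℝ)..c, (0:ℂ) :=
      intervalIntegral.integral_congr fun y hy => by rw [uIcc_of_le h0] at hy; exact hzl y hy
    rw [e, intervalIntegral.integral_zero]
  have z3 : ∫ y in d..(1:ℝ), f y = 0 := by
    have e : ∫ y in d..(1:ℝ), f y = ∫ _ in d..(1:ℝ), (0:ℂ) :=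
      intervalIntegral.integral_congr fun y hy => by rw [uIcc_of_le hd] at hy; exact hzr y hy
    rw [e, intervalIntegral.integral_zero]
  rw [← intervalIntegral.integral_add_adjacent_intervals hic (hcd'.trans hd1),
    ← intervalIntegral.integral_add_adjacent_intervals hcd' hd1, z1, z3, zero_add, add_zero]
  exact intervalIntegral.integral_congr_uIoo (by rwa [uIoo_of_le hcd])

/-! ### The restriction of `Xw` -/

variable {νa ka νb kb : ℝ}

/-- Pointwise facts on the reflected piece OUTSIDE the window (left part `y ≤ 1 − ν_b`): `ϰ_b(1−y) = 0`,
`ϰ_b′(1−y) = 0`, `∫_{1−y}^1 ϰ_b = 0`. [cite: Zhang2022LandauSiegel, §12 (12.1)–(12.2)] -/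
theorem refl_piece_zero_left (hb : 0 < νb) {y : ℝ} (hy0 : 0 ≤ y) (hy : y ≤ 1 - νb) :
    reflProfile (kappaP νb kb) y = 0 ∧ reflDeriv (kappaP' νb kb) y = 0
      ∧ (∫ t in (0:ℝ)..y, reflProfile (kappaP νb kb) t) = 0 := by
  refine ⟨?_, ?_, ?_⟩
  · simp [reflProfile, kappaP_of_ge hb.ne' (show νb ≤ 1 - y by linarith)]
  · simp [reflDeriv, kappaP'_of_ge (show νb ≤ 1 - y by linarith)]
  · rw [integral_reflProfile, integral_kappaP_tail_of_ge hb (by linarith) (by linarith), map_zero]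

/-- **`Xw` as five window integrals**: for `0 < ν_a ≤ 1`, `0 < ν_b ≤ 1`, `k_b ≠ 0`, `1 − ν_b ≤ ν_a`,
`Xw ν_a k_a ν_b k_b = −(8/π)J₁ + 88π·J₂ − 24i(J₃ + J₄) − 48π²i·J₅`.
[cite: Zhang2022LandauSiegel, §12 (12.12)–(12.14); §18 (18.1)] -/
theorem Xw_eq_window_integrals (ha : 0 < νa) (ha1 : νa ≤ 1) (hb : 0 < νb) (hb1 : νb ≤ 1)
    (hkb : kb ≠ 0) (hL : 1 - νb ≤ νa) :
    Xw νa ka νb kb = -((8 / π : ℝ) : ℂ) * J1w νa ka νb kb + ((88 * π : ℝ) : ℂ) * J2w νa ka νb kb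
      - 24 * I * (J3w νa ka νb kb + J4w νa ka νb kb) - ((48 * π ^ 2 : ℝ) : ℂ) * I * J5w νa ka νb kb := by
  have Ka := (kinkedProfile_kappaP (k := ka) ha ha1).isH1
  have Kb := (kinkedProfile_kappaP (k := kb) hb hb1).isH1.refl
  have h0 : 0 ≤ 1 - νb := by linarith
  -- the five restrictions
  have e1 : (∫ y in (0:ℝ)..1, kappaP' νa ka y * conj (reflDeriv (kappaP' νb kb) y)) = -J1w νa ka νb kb := by
    rw [J1w, ← intervalIntegral.integral_neg]
    refine integral_unit_eq_window (Ka.intervalIntegrable_deriv_mul_conj_deriv Kb) h0 hL ha1 ?_ ?_ ?_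
    · intro y hy; rw [(refl_piece_zero_left hb hy.1 hy.2).2.1, map_zero, mul_zero]
    · intro y hy; rw [kappaP'_of_ge hy.1, zero_mul]
    · intro y hy
      have h1 : 1 - y < νb := by linarith [hy.1]
      simp only [reflDeriv, map_neg, Complex.conj_conj, kappaP'_eq_kapSm' hy.2, kappaP'_eq_kapSm' h1]
      ring
  have e2 : (∫ y in (0:ℝ)..1, kappaP νa ka y * conj (reflProfile (kappaP νb kb) y)) = J2w νa ka νb kb := by
    rw [J2w]
    refine integral_unit_eq_window (Ka.intervalIntegrable_mul_conj Kb) h0 hL ha1 ?_ ?_ ?_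
    · intro y hy; rw [(refl_piece_zero_left hb hy.1 hy.2).1, map_zero, mul_zero]
    · intro y hy; rw [kappaP_of_ge ha.ne' hy.1, zero_mul]
    · intro y hy
      have h1 : 1 - y ≤ νb := by linarith [hy.1]
      simp only [reflProfile, Complex.conj_conj, kappaP_eq_kapSm hy.2.le, kappaP_eq_kapSm h1]
  have e3 : (∫ y in (0:ℝ)..1, kappaP' νa ka y * conj (reflProfile (kappaP νb kb) y)) = J3w νa ka νb kb := by
    rw [J3w]
    refine integral_unit_eq_window (Ka.intervalIntegrable_deriv_mul_conj Kb) h0 hL ha1 ?_ ?_ ?_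
    · intro y hy; rw [(refl_piece_zero_left hb hy.1 hy.2).1, map_zero, mul_zero]
    · intro y hy; rw [kappaP'_of_ge hy.1, zero_mul]
    · intro y hy
      have h1 : 1 - y ≤ νb := by linarith [hy.1]
      simp only [reflProfile, Complex.conj_conj, kappaP'_eq_kapSm' hy.2, kappaP_eq_kapSm h1]
  have e4 : (∫ y in (0:ℝ)..1, kappaP νa ka y * conj (reflDeriv (kappaP' νb kb) y)) = -J4w νa ka νb kb := by
    rw [J4w, ← intervalIntegral.integral_neg]
    refine integral_unit_eq_window (intervalIntegrable_mul_conj_deriv' Ka Kb) h0 hL ha1 ?_ ?_ ?_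
    · intro y hy; rw [(refl_piece_zero_left hb hy.1 hy.2).2.1, map_zero, mul_zero]
    · intro y hy; rw [kappaP_of_ge ha.ne' hy.1, zero_mul]
    · intro y hy
      have h1 : 1 - y < νb := by linarith [hy.1]
      simp only [reflDeriv, map_neg, Complex.conj_conj, kappaP_eq_kapSm hy.2.le, kappaP'_eq_kapSm' h1]
      ring
  have e5 : (∫ x in (0:ℝ)..1, kappaP νa ka x * conj (∫ t in (0:ℝ)..x, reflProfile (kappaP νb kb) t))
      = J5w νa ka νb kb := by
    rw [J5w]
    refine integral_unit_eq_window (Ka.intervalIntegrable_mul_conj_primitive Kb) h0 hL ha1 ?_ ?_ ?_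
    · intro y hy; rw [(refl_piece_zero_left hb hy.1 hy.2).2.2, map_zero, mul_zero]
    · intro y hy; rw [kappaP_of_ge ha.ne' hy.1, zero_mul]
    · intro x hx
      have h1 : 1 - x ≤ νb := by linarith [hx.1]
      simp only [kappaP_eq_kapSm hx.2.le, integral_reflProfile, Complex.conj_conj,
        integral_kappaP_tail hkb hb hb1 h1]
  unfold Xw windowForm
  rw [e1, e2, e3, e4, e5]
  ring

/-- Hence on the admissible class the K-S2 discrepancy of record is an explicit combination of ten
window integrals (five per window) minus `2e₂*`. [cite: Zhang2022LandauSiegel, §12 (12.12)–(12.17); §18 (18.1)–(18.2)] -/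
theorem discS_eq_window_integrals {θ : Theta} (h : AdmissibleTheta θ) :
    discS θ = conj θ.iota4 * (-((8 / π : ℝ) : ℂ) * J1w θ.nu1 θ.k1 θ.nu2 θ.k2
        + ((88 * π : ℝ) : ℂ) * J2w θ.nu1 θ.k1 θ.nu2 θ.k2
        - 24 * I * (J3w θ.nu1 θ.k1 θ.nu2 θ.k2 + J4w θ.nu1 θ.k1 θ.nu2 θ.k2)
        - ((48 * π ^ 2 : ℝ) : ℂ) * I * J5w θ.nu1 θ.k1 θ.nu2 θ.k2)
      + conj θ.iota3 * (-((8 / π : ℝ) : ℂ) * J1w θ.nu1 θ.k1 θ.nu3 θ.k3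
        + ((88 * π : ℝ) : ℂ) * J2w θ.nu1 θ.k1 θ.nu3 θ.k3
        - 24 * I * (J3w θ.nu1 θ.k1 θ.nu3 θ.k3 + J4w θ.nu1 θ.k1 θ.nu3 θ.k3)
        - ((48 * π ^ 2 : ℝ) : ℂ) * I * J5w θ.nu1 θ.k1 θ.nu3 θ.k3)
      - 2 * e2starT θ := by
  have h' := h
  obtain ⟨⟨h32, h21⟩, ⟨h3h, h2h, h1h⟩, h1, h13, -, ⟨⟨-, -⟩, ⟨hk2, -⟩, ⟨hk3, -⟩⟩, -⟩ := h'
  unfold Theta.belowP at h1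
  unfold Theta.dualRangesNonempty at h13
  rw [discS_eq_windows h,
    Xw_eq_window_integrals (by linarith) h1.le (by linarith) (by linarith) hk2.ne' (by linarith),
    Xw_eq_window_integrals (by linarith) h1.le (by linarith) (by linarith) hk3.ne' (by linarith)]

end Repair

end Literature.NumberTheory.LFunctions.Zhang2022
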